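import Summits.QuantumFields.BalabanUV.Beta.D1BFx.LocalVertexBound
import Summits.QuantumFields.BalabanUV.Beta.D1BFx.NeedleProjLettersD1
import Summits.QuantumFields.BalabanUV.Beta.D1BFx.NeedleProjProjRow
import Summits.QuantumFields.BalabanUV.Beta.D1BFx.GluonNeedleGlue
import Summits.QuantumFields.BalabanUV.Beta.D1BFx.GluonLegProfile

/-!
# `BalabanUV.Beta.D1BFx.GluonLocalProjWord` — road «BF-x» for binder row D1, slot (K), END row `hGrp gN`, «GN-P» part 1: THE `SbT ⊗ proj` WORD OF THE GLUON
# NEEDLE ROW T₁ AT ONE `(b, w)` — frame × letters: `|word(b,w)| ≤ K·[A₁c₃e^{−(δ∕n)‖w‖}∕nrm(w)³·(KC + KC₁) + A₀c₂e^{−(δ∕n)‖w‖}∕nrm(w)²·KC₁]`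
# (abstract letters; the cell `|cellSum n a SbT (projPiece n a) μ ν| ≤ C_P` is part 2, `GluonLocalProjRow`)

HONEST DEPENDENCY (cell records, verbatim): «continuum YM on T⁴ ⇐ BetaPertH ∧ nine spine estimates (0/9 proved); BetaPertH ⇐ (D1) ∧ (D4) ∧
CAP+tail; G-an2-4 gates asym, D1 and NE2/3/4.»  HONEST FRAMING (cell contract, verbatim): «discharging `BetaPertH` makes Bałaban's UV stability
UNCONDITIONAL — a real constructive-QFT result; it is NOT the continuum limit and NOT the Clay problem.»  THIS MODULE DISCHARGES NOTHING of the
wall: [folklore] counting, modulo the two NAMED printed statements `B5.Prop12Printed (fam nOf hn1 MOf a ha)` ([B5, Prop. 1.2]) and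
`B5.Kernel126_127Printed (kfam nOf MOf)` ([B5, (1.126)–(1.127)]) which enter ONLY through the letters (`GluonLegProfile.exists_abs_Ga_le_profile`,
`GluonLegProfileD1.exists_abs_Ga_diff(_left)_le_profile`, `NeedleProjLetters.exists_applyK_colGrad_le`∕`_applyKT_rowGrad_le`,
`NeedleProjLettersD1.exists_applyK_colGrad_diff_le`∕`_applyKT_rowGrad_diff_le`, `GluonLegTails.spr_Ga_of_prop12`) — hypotheses, never proved here —
composed with the owner's frame `LocalVertexForm.exists_SbT_outer_bound` (absolute `K`, `R`), `RankOneBubble(Jets)` (`dJetSw_eq_outer_sub`,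
`applyK(T)_bondInd`, `bubble_outer_sub_right`, `locV_*`), `SectorRecut.exists_biLoc_SbT`, `RJetProjector.decays_Pgt`, `ProjectorSupNorm.abs_Pgt_diff_le_sup`,
leaf-04-g9's `LatticeHLSRadial.sum_exp_div_nrm_pow_le`, `NeedleProjProjRow` (`abs_weight_le_sq`, `sum_exp_scale_le`, `sum_resSite_avg_le`),
`WindowIdentification.fullSum_eq_tsum_sub`.  No `def`, no `def … : Prop`, nothing cited beyond those two named statements, 0 sorry.  Root-level binders
hW ∕ hR-sockets ∕ hSX-socket ∕ D1Tel ∕ D1Rep — 0 discharged; (K) NOT closed; NOT D1, NOT `BetaPertH`, NOT continuum, NOT Clay.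

ABSOLUTE RULE (cell charter, verbatim): «No internally-minted statement may enter as a cited fact. Every hypothesis is either kernel-proved in
this package or a verbatim quotation of a PUBLISHED theorem with page reference. The manuscript(s) under audit are NOT citable for their own
disputed steps — they are the thing under adjudication; programme-internal (2001/route/tribunal) claims are never citable.»

WHY (owner records `HOME/b2b-balaban-beta-d1-p2/GLUON-NEEDLE-ROWS.md` v0.2 «GN-CELLS», row «T₁∕T₂ P-piece `SbT ⊗ proj`»; an3-g57 `N36-SPLIT.v1.md` §3′ (4)).
THE COUNT.  The word at `(b, w)` is `−½·bubble Ga (SbT μ (b+w)) (dJetSw ν b P)`, `dJetSw ν b P = c′ ⊗ δ − δ ⊗ r′` (`c′ = ∇_col P(·, b+e_ν)`,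
`r′ = ∇_row P(b+e_ν, ·)`, `δ = δ_{(b,ν)}`).  By the frame each of the two terms is `≤ K·(Φ₁Γ₀ + Φ₀Γ₁ + Φ₁Γ₁)` with the window bounds of its two
ENDS around the vertex `u = b + w` (radius `R`): term 1 has row end `Ga(b, ·)` (`Φ₀ = A₀·c₂·e^{−(δ∕n)‖w‖}∕nrm(w)²`, `Φ₁ = A₁·c₃·e∕nrm(w)³` — entry and
second-variable d1 profiles of the leg, the window shift costing `c_p = e^{δR}(R+1)^p`) and column end `Ga c′` (`Γ₀ = kC∕n³`, `Γ₁ = kC′∕n⁴`); term 2 has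
row end `r′Ga` (`kC∕n³`, `kC′∕n⁴`) and column end `Ga(·, b)` (entry and first-variable d1 profiles) — the same three products.  The (1.22) sum:
`|w_μw_ν| ≤ nrm(w)²`, so `Σ_w nrm²·[A₁c₃e∕nrm³·(kC+kC′)n⁻³ + A₀c₂e∕nrm²·kC′n⁻⁴] ≤ A₁c₃(kC+kC′)·n⁻³·Σ_w e∕nrm + A₀c₂kC′·n⁻⁴·Σ_w e ≍ n⁻³·n³ + n⁻⁴·n⁴ = n⁰`
(`sum_exp_div_nrm_pow_le` at `p = 1`, `sum_exp_scale_le`); the base average is convex (`sum_resSite_avg_le`).  an3 predicted `n⁻¹` for this piece;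
`n⁰` is what `hp` needs and what these letters give.
* §1 [folklore] window shifts: `supNorm_le_window`, `nrm_le_window`, `exp_window`, `profile_window`.
* §2 [folklore] **`abs_locProj_word_le`** (pointwise, abstract letters and an abstract frame `K, R`).
NOT HERE (honest): the (1.22) sum and the cell (part 2 `GluonLocalProjRow`); the T₂ mirror; the K- and Q̇-pieces.
Unit `b2b-balaban-beta-d1-p2` (gen 10), road «BF-x» OWNER; `LEAVES-BFx.md` row (N) «GN-P» part 1.
-/

namespace Summit.QuantumFields.BalabanUV.Beta.D1BFx.GluonLocalProjWord

open Finset Real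
open scoped BigOperators
open Literature.MathematicalPhysics.QuantumFieldTheory.Balaban1983to89
open Literature.MathematicalPhysics.QuantumFieldTheory.Balaban1983to89.Beta
open B12Sec2to5 (l1 l1_nonneg)
open B4Sect5Proof (latticeConst latticeConst_nonneg)
open B6QGQLower276 (X e blk B mem_B)
open ExpKernelCalculus (Site MKer Decays bubble summable_exp_shift summable_exp_shift' l1_sub_symm)
open DyadicShell (Pt toReal toReal_apply)
open BubbleTransfer (unitVec)
open WindowIdentification (fullSum fullSum_eq_tsum_sub)
open DressedMomentNormalisation (resSite)
open VectorTailsLoc (fam kfam)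
open PoissonInterior (nrm nrm_pos one_le_nrm nrm_neg supNorm supNorm_neg supNorm_add_le)
open Summit.QuantumFields.BalabanUV.Beta.TameKernelCalculus (Spr Loc)
open Summit.QuantumFields.BalabanUV.Beta.D1BFx.PackedKernelSplit (biBubble bubble_eq_biBubble)
open Summit.QuantumFields.BalabanUV.Beta.D1BFx.FineHessianSectors (biBubbleTable biBubbleTable_apply)
open Summit.QuantumFields.BalabanUV.Beta.D1BFx.RProjector (Pgt Pgt_symm deltaPP deltaPP_pos)
open Summit.QuantumFields.BalabanUV.Beta.D1BFx.RJetProjector (decays_Pgt)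
open Summit.QuantumFields.BalabanUV.Beta.D1BFx.ProjectorSupNorm (cPPs cPPs_nonneg abs_Pgt_diff_le_sup)
open Summit.QuantumFields.BalabanUV.Beta.D1BFx.GluonLeg (Ga Ga_apply Ga_symm)
open Summit.QuantumFields.BalabanUV.Beta.D1BFx.GluonLegTails (spr_Ga_of_prop12)
open Summit.QuantumFields.BalabanUV.Beta.D1BFx.GluonLegProfile (exists_abs_Ga_le_profile)
open Summit.QuantumFields.BalabanUV.Beta.D1BFx.GluonLegProfileD1 (exists_abs_Ga_diff_le_profile exists_abs_Ga_diff_left_le_profile)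
open Summit.QuantumFields.BalabanUV.Beta.D1BFx.GhostLeg (cast_pred_add_one)
open Summit.QuantumFields.BalabanUV.Beta.D1BFx.FrozenLegTails (nOf MOf hn1)
open Summit.QuantumFields.BalabanUV.Beta.D1BFx.SectorRecut (SbT exists_biLoc_SbT)
open Summit.QuantumFields.BalabanUV.Beta.D1BFx.GluonNeedleSplit (projPiece projPiece_apply)
open Summit.QuantumFields.BalabanUV.Beta.D1BFx.GluonNeedleGlue (cellSum cellSum_def)
open Summit.QuantumFields.BalabanUV.Beta.D1BFx.RankOneBubble (outer applyK applyKT pairing applyK_apply applyKT_apply bubble_outer_sub_right LocV)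
open Summit.QuantumFields.BalabanUV.Beta.D1BFx.RankOneBubbleJets (bondInd bondInd_apply colGrad rowGrad dJetSw_eq_outer_sub applyK_bondInd applyKT_bondInd
  locV_bondInd locV_colGrad locV_rowGrad)
open Summit.QuantumFields.BalabanUV.Beta.D1BFx.NeedleProjLetters (exists_applyK_colGrad_le exists_applyKT_rowGrad_le unitVec_eq_e')
open Summit.QuantumFields.BalabanUV.Beta.D1BFx.NeedleProjLettersD1 (exists_applyK_colGrad_diff_le exists_applyKT_rowGrad_diff_le)
open Summit.QuantumFields.BalabanUV.Beta.D1BFx.NeedleProjProjRow (abs_weight_le_sq sum_exp_scale_le sum_resSite_avg_le)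
open Summit.QuantumFields.BalabanUV.Beta.D1BFx.LatticeHLSProfiles (supNorm_dyadic)
open Summit.QuantumFields.BalabanUV.Beta.D1BFx.LatticeHLSRadial (nrm_eq_max sum_exp_div_nrm_pow_le)
open Summit.QuantumFields.BalabanUV.Beta.D1BFx.LocalVertexForm (exists_SbT_outer_bound)

noncomputable section

/-! ## §1 Window shifts: a profile centred at `b`, read at `b + w + r` with `‖r‖∞ ≤ R` -/

/-- [folklore] `‖w‖∞ ≤ ‖w + r‖∞ + R` for `‖r‖∞ ≤ R`. -/
theorem supNorm_le_window {w r : Pt} {R : ℕ} (hr : supNorm (d := 4) r ≤ R) : supNorm (d := 4) w ≤ supNorm (d := 4) (w + r) + R := by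
  have h1 : supNorm (d := 4) w ≤ supNorm (d := 4) (w + r) + supNorm (d := 4) (-r) := by
    have e1 : w = (w + r) + -r := by abel
    conv_lhs => rw [e1]
    exact supNorm_add_le _ _
  rw [supNorm_neg] at h1
  omega

/-- [folklore] `nrm w ≤ (R + 1)·nrm (w + r)` for `‖r‖∞ ≤ R`. -/
theorem nrm_le_window {w r : Pt} {R : ℕ} (hr : supNorm (d := 4) r ≤ R) : nrm (d := 4) w ≤ ((R : ℝ) + 1) * nrm (d := 4) (w + r) := by
  have h1 : (supNorm (d := 4) w : ℝ) ≤ supNorm (d := 4) (w + r) + R := by exact_mod_cast supNorm_le_window hr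
  have h2 : (supNorm (d := 4) (w + r) : ℝ) ≤ nrm (d := 4) (w + r) := by rw [nrm_eq_max]; exact le_max_right _ _
  have h3 := one_le_nrm (d := 4) (w + r)
  have hR : (0 : ℝ) ≤ R := by positivity
  rw [nrm_eq_max]
  refine max_le (by nlinarith) ?_
  calc ((supNorm (d := 4) w : ℕ) : ℝ) ≤ nrm (d := 4) (w + r) + R := by linarith
    _ ≤ nrm (d := 4) (w + r) + R * nrm (d := 4) (w + r) := by nlinarith
    _ = ((R : ℝ) + 1) * nrm (d := 4) (w + r) := by ring

/-- [folklore] the scale-`n` damping read in the window: `e^{−(δ∕n)‖w+r‖} ≤ e^{δR}·e^{−(δ∕n)‖w‖}` for `‖r‖∞ ≤ R`, `n ≥ 1`, `δ ≥ 0`. -/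
theorem exp_window {δ : ℝ} (hδ : 0 ≤ δ) {n : ℕ} (hn : 1 ≤ n) {w r : Pt} {R : ℕ} (hr : supNorm (d := 4) r ≤ R) :
    Real.exp (-(δ / n) * supNorm (d := 4) (w + r)) ≤ Real.exp (δ * R) * Real.exp (-(δ / n) * supNorm (d := 4) w) := by
  rw [← Real.exp_add, Real.exp_le_exp]
  have h1 : (supNorm (d := 4) w : ℝ) ≤ supNorm (d := 4) (w + r) + R := by exact_mod_cast supNorm_le_window hr
  have hn' : (1 : ℝ) ≤ n := by exact_mod_cast hn
  have hn0 : (0 : ℝ) < n := by linarith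
  have h2 : δ / n * R ≤ δ * R := by
    rw [div_mul_eq_mul_div]; exact div_le_self (by positivity) hn'
  have h3 : δ / n * supNorm (d := 4) w ≤ δ / n * (supNorm (d := 4) (w + r) + R) := mul_le_mul_of_nonneg_left h1 (by positivity)
  nlinarith

/-- [folklore] **A DAMPED POWER PROFILE CENTRED AT `b`, READ IN THE WINDOW AROUND `b + w`**:
`k·e^{−(δ∕n)‖w+r‖}∕nrm(w+r)^p ≤ k·(e^{δR}(R+1)^p)·e^{−(δ∕n)‖w‖}∕nrm(w)^p` for `‖r‖∞ ≤ R`. -/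
theorem profile_window {k δ : ℝ} (hk : 0 ≤ k) (hδ : 0 ≤ δ) {n : ℕ} (hn : 1 ≤ n) (p : ℕ) {w r : Pt} {R : ℕ} (hr : supNorm (d := 4) r ≤ R) :
    k * Real.exp (-(δ / n) * supNorm (d := 4) (w + r)) / nrm (d := 4) (w + r) ^ p
      ≤ k * (Real.exp (δ * R) * ((R : ℝ) + 1) ^ p) * (Real.exp (-(δ / n) * supNorm (d := 4) w) / nrm (d := 4) w ^ p) := by
  have h1 := exp_window hδ hn (w := w) hr
  have h2 := nrm_le_window (w := w) hr
  have hw := nrm_pos (d := 4) w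
  have hwr := nrm_pos (d := 4) (w + r)
  have h3 : 1 / nrm (d := 4) (w + r) ^ p ≤ ((R : ℝ) + 1) ^ p / nrm (d := 4) w ^ p := by
    rw [div_le_div_iff₀ (by positivity) (by positivity), one_mul, ← mul_pow]
    exact pow_le_pow_left₀ hw.le h2 p
  calc k * Real.exp (-(δ / n) * supNorm (d := 4) (w + r)) / nrm (d := 4) (w + r) ^ p
      = k * Real.exp (-(δ / n) * supNorm (d := 4) (w + r)) * (1 / nrm (d := 4) (w + r) ^ p) := by ring
    _ ≤ k * (Real.exp (δ * R) * Real.exp (-(δ / n) * supNorm (d := 4) w)) * (((R : ℝ) + 1) ^ p / nrm (d := 4) w ^ p) :=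
        mul_le_mul (mul_le_mul_of_nonneg_left h1 hk) h3 (by positivity) (by positivity)
    _ = _ := by ring

/-! ## §2 The word at one `(b, w)`: frame × letters -/

section Word

variable (n : ℕ) [NeZero n] (a : ℝ)

/-- [folklore] **THE `SbT ⊗ proj` WORD AT ONE `(b, w)`** from an abstract frame (`K`, `R` with the conclusion of
`LocalVertexForm.exists_SbT_outer_bound`) and abstract letters: the entry profile `A₀e^{−(δ∕n)‖·‖}∕nrm²` of `Ga`, its two d1 profiles `A₁e∕nrm³`,
the sup letters `KC` (point values of `Ga` on projector column ∕ row gradients) and `KC₁` (their unit differences):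
`|biBubbleTable Ga Ga SbT proj μ ν (b+w) b| ≤ K·[A₁c₃E₃(w)·(KC + KC₁) + A₀c₂E₂(w)·KC₁]`, `E_p(w) = e^{−(δ∕n)‖w‖}∕nrm(w)^p`, `c_p = e^{δR}(R+1)^p`. -/
theorem abs_locProj_word_le (ha : 0 < a) (hA : Spr (Ga n a)) {K : ℝ} {R : ℕ}
    (hframe : ∀ (κ : Fin 4) (u : Pt) (A B : MKer 4 (Fin 4)) (φ ψ : Pt → Fin 4 → ℝ),
      (∀ (s : Pt) (g : Fin 4), Summable fun x : Pt => ∑ a', ψ x a' * A x s a' g) →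
      ∀ (Φ₀ Φ₁ Γ₀ Γ₁ : ℝ), 0 ≤ Φ₀ → 0 ≤ Φ₁ → 0 ≤ Γ₀ → 0 ≤ Γ₁ →
      (∀ (q : Pt) (g : Fin 4), DyadicShell.supNorm (q - u) ≤ R → |applyKT ψ A q g| ≤ Φ₀) →
      (∀ (q : Pt) (g : Fin 4) (i : Fin 4), DyadicShell.supNorm (q - u) ≤ R → |applyKT ψ A (q + unitVec i) g - applyKT ψ A q g| ≤ Φ₁) →
      (∀ (q : Pt) (f : Fin 4), DyadicShell.supNorm (q - u) ≤ R → |applyK B φ q f| ≤ Γ₀) →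
      (∀ (q : Pt) (f : Fin 4) (i : Fin 4), DyadicShell.supNorm (q - u) ≤ R → |applyK B φ (q + unitVec i) f - applyK B φ q f| ≤ Γ₁) →
      |biBubble A (SbT κ u) B (outer φ ψ)| ≤ K * (Φ₁ * Γ₀ + Φ₀ * Γ₁ + Φ₁ * Γ₁))
    {A₀ A₁ δ KC KC₁ : ℝ} (hA₀ : 0 ≤ A₀) (hA₁ : 0 ≤ A₁) (hδ : 0 < δ) (hKC : 0 ≤ KC) (hKC₁ : 0 ≤ KC₁)
    (hprof : ∀ (x y : Pt) (κ l : Fin 4), |Ga n a x y κ l| ≤ A₀ * Real.exp (-(δ / n) * supNorm (d := 4) (y - x)) / nrm (d := 4) (y - x) ^ 2)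
    (hdR : ∀ (x y : Pt) (κ l ρ : Fin 4), |Ga n a x (y + unitVec ρ) κ l - Ga n a x y κ l|
      ≤ A₁ * Real.exp (-(δ / n) * supNorm (d := 4) (y - x)) / nrm (d := 4) (y - x) ^ 3)
    (hdL : ∀ (x y : Pt) (κ l ρ : Fin 4), |Ga n a (x + unitVec ρ) y κ l - Ga n a x y κ l|
      ≤ A₁ * Real.exp (-(δ / n) * supNorm (d := 4) (x - y)) / nrm (d := 4) (x - y) ^ 3)
    (hC0 : ∀ (q x : Pt) (α : Fin 4), |applyK (Ga n a) (colGrad (Pgt n a) q) x α| ≤ KC)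
    (hC1 : ∀ (q x : Pt) (α i : Fin 4), |applyK (Ga n a) (colGrad (Pgt n a) q) (x + unitVec i) α - applyK (Ga n a) (colGrad (Pgt n a) q) x α| ≤ KC₁)
    (hT0 : ∀ (p z : Pt) (β : Fin 4), |applyKT (rowGrad (Pgt n a) p) (Ga n a) z β| ≤ KC)
    (hT1 : ∀ (p z : Pt) (β i : Fin 4), |applyKT (rowGrad (Pgt n a) p) (Ga n a) (z + unitVec i) β - applyKT (rowGrad (Pgt n a) p) (Ga n a) z β| ≤ KC₁)
    (μ ν : Fin 4) (b w : Pt) :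
    |biBubbleTable (Ga n a) (Ga n a) SbT (projPiece n a) μ ν (b + w) b|
      ≤ K * (A₁ * (Real.exp (δ * R) * ((R : ℝ) + 1) ^ 3) * (Real.exp (-(δ / n) * supNorm (d := 4) w) / nrm (d := 4) w ^ 3) * (KC + KC₁)
        + A₀ * (Real.exp (δ * R) * ((R : ℝ) + 1) ^ 2) * (Real.exp (-(δ / n) * supNorm (d := 4) w) / nrm (d := 4) w ^ 2) * KC₁) := by
  have hn1 : 1 ≤ n := NeZero.one_le
  have hn : (0 : ℝ) < n := by exact_mod_cast Nat.pos_of_ne_zero (NeZero.ne n)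
  set u : Pt := b + w with hu
  -- the shifted envelopes
  set E₂ : ℝ := Real.exp (-(δ / n) * supNorm (d := 4) w) / nrm (d := 4) w ^ 2 with hE₂
  set E₃ : ℝ := Real.exp (-(δ / n) * supNorm (d := 4) w) / nrm (d := 4) w ^ 3 with hE₃
  set c₂ : ℝ := Real.exp (δ * R) * ((R : ℝ) + 1) ^ 2 with hc₂
  set c₃ : ℝ := Real.exp (δ * R) * ((R : ℝ) + 1) ^ 3 with hc₃
  have hnw := nrm_pos (d := 4) w
  have hE₂0 : 0 ≤ E₂ := by rw [hE₂]; positivity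
  have hE₃0 : 0 ≤ E₃ := by rw [hE₃]; positivity
  -- window bookkeeping: `q - b = w + (q - u)` and `‖q - u‖ ≤ R`
  have hwin : ∀ q : Pt, DyadicShell.supNorm (q - u) ≤ R → supNorm (d := 4) (q - u) ≤ R := fun q hq => by rwa [supNorm_dyadic] at hq
  have hqb : ∀ q : Pt, q - b = w + (q - u) := fun q => by rw [hu]; abel
  have hΦ₀ : ∀ (q : Pt) (κ l : Fin 4), DyadicShell.supNorm (q - u) ≤ R → |Ga n a b q κ l| ≤ A₀ * c₂ * E₂ := by
    intro q κ l hq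
    refine (hprof b q κ l).trans ?_
    rw [hqb q]
    exact (profile_window hA₀ hδ.le hn1 2 (hwin q hq)).trans (le_of_eq (by rw [hc₂, hE₂]))
  have hΦ₁ : ∀ (q : Pt) (κ l i : Fin 4), DyadicShell.supNorm (q - u) ≤ R → |Ga n a b (q + unitVec i) κ l - Ga n a b q κ l| ≤ A₁ * c₃ * E₃ := by
    intro q κ l i hq
    refine (hdR b q κ l i).trans ?_
    rw [hqb q]
    exact (profile_window hA₁ hδ.le hn1 3 (hwin q hq)).trans (le_of_eq (by rw [hc₃, hE₃]))
  have hΓ₀' : ∀ (q : Pt) (κ l : Fin 4), DyadicShell.supNorm (q - u) ≤ R → |Ga n a q b κ l| ≤ A₀ * c₂ * E₂ := by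
    intro q κ l hq
    refine (hprof q b κ l).trans ?_
    have e1 : supNorm (d := 4) (b - q) = supNorm (d := 4) (q - b) := by rw [show b - q = -(q - b) by abel, supNorm_neg]
    have e2 : nrm (d := 4) (b - q) = nrm (d := 4) (q - b) := by rw [show b - q = -(q - b) by abel, nrm_neg]
    rw [e1, e2, hqb q]
    exact (profile_window hA₀ hδ.le hn1 2 (hwin q hq)).trans (le_of_eq (by rw [hc₂, hE₂]))
  have hΓ₁' : ∀ (q : Pt) (κ l i : Fin 4), DyadicShell.supNorm (q - u) ≤ R → |Ga n a (q + unitVec i) b κ l - Ga n a q b κ l| ≤ A₁ * c₃ * E₃ := by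
    intro q κ l i hq
    refine (hdL q b κ l i).trans ?_
    rw [hqb q]
    exact (profile_window hA₁ hδ.le hn1 3 (hwin q hq)).trans (le_of_eq (by rw [hc₃, hE₃]))
  -- localisation data for the split of `dJetSw`
  have hP := decays_Pgt n (a := a) ha
  have hδP : 0 < deltaPP 4 a / (4 * (n : ℝ)) := by have := deltaPP_pos 4 ha; positivity
  obtain ⟨Cs, δs, hδs, hS⟩ := exists_biLoc_SbT
  have hLocS : Loc (SbT μ u) := ⟨u, u, Cs, δs, hδs, hS μ u⟩
  set c' : Pt → Fin 4 → ℝ := colGrad (Pgt n a) (b + (AffineAveraging.unitVec ν : Pt)) with hc'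
  set r' : Pt → Fin 4 → ℝ := rowGrad (Pgt n a) (b + (AffineAveraging.unitVec ν : Pt)) with hr'
  -- the word, split into the two rank-one terms
  have hword : biBubbleTable (Ga n a) (Ga n a) SbT (projPiece n a) μ ν (b + w) b =
      -(1 / 2 : ℝ) * (bubble (Ga n a) (SbT μ u) (outer c' (bondInd ν b)) - bubble (Ga n a) (SbT μ u) (outer (bondInd ν b) r')) := by
    rw [biBubbleTable_apply, projPiece_apply, dJetSw_eq_outer_sub, ← bubble_eq_biBubble, ← hu,
      bubble_outer_sub_right hA hLocS (locV_colGrad hP hδP _) (locV_bondInd ν b) (locV_bondInd ν b) (locV_rowGrad hP hδP _)]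
  -- summability of the two row ends
  have hsum1 : ∀ (s : Pt) (g : Fin 4), Summable fun x : Pt => ∑ a', bondInd ν b x a' * Ga n a x s a' g := by
    intro s g
    refine summable_of_ne_finset_zero (s := {b}) fun x hx => ?_
    rw [Finset.mem_singleton] at hx
    exact Finset.sum_eq_zero fun a' _ => by rw [bondInd_apply, if_neg (fun h => hx h.1), zero_mul]
  have hsum2 : ∀ (s : Pt) (g : Fin 4), Summable fun x : Pt => ∑ a', r' x a' * Ga n a x s a' g := by
    intro s g
    obtain ⟨C, δ', hδ', hGa⟩ := hA
    have hC : 0 ≤ C := hGa.nonneg g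
    have hr'b : ∀ (x : Pt) (a' : Fin 4), |r' x a'| ≤ cPPs 4 a / (n : ℝ) ^ 5 := by
      intro x a'
      set p : Pt := b + (AffineAveraging.unitVec ν : Pt) with hp
      rw [hr', show rowGrad (Pgt n a) p x a' = Pgt n a p (x + e a') () () - Pgt n a p x () () from rfl, Pgt_symm n ha p (x + e a'),
        Pgt_symm n ha p x]
      refine (abs_Pgt_diff_le_sup n ha x p a' () ()).trans (mul_le_of_le_one_right (by have := cPPs_nonneg 4 ha; positivity) ?_)
      rw [Real.exp_le_one_iff]; have : 0 ≤ deltaPP 4 a * dist (blk (n - 1) x) (blk (n - 1) p) := by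
        have := deltaPP_pos 4 ha; positivity
      linarith
    refine Summable.of_norm_bounded (g := fun x => ∑ _a' : Fin 4, cPPs 4 a / (n : ℝ) ^ 5 * (C * Real.exp (-δ' * l1 (x - s)))) ?_ fun x => ?_
    · exact summable_sum fun a' _ => ((summable_exp_shift' hδ' s).mul_left C).mul_left _
    · rw [Real.norm_eq_abs]
      refine (Finset.abs_sum_le_sum_abs _ _).trans (Finset.sum_le_sum fun a' _ => ?_)
      rw [abs_mul]
      exact mul_le_mul (hr'b x a') (hGa x s a' g) (abs_nonneg _) (by have := cPPs_nonneg 4 ha; positivity)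
  -- term 1: row end `Ga(b, ·)`, column end `Ga c′`
  have ht1 : |bubble (Ga n a) (SbT μ u) (outer c' (bondInd ν b))| ≤ K * (A₁ * c₃ * E₃ * KC + A₀ * c₂ * E₂ * KC₁ + A₁ * c₃ * E₃ * KC₁) := by
    rw [bubble_eq_biBubble]
    refine hframe μ u (Ga n a) (Ga n a) c' (bondInd ν b) hsum1 (A₀ * c₂ * E₂) (A₁ * c₃ * E₃) KC KC₁ (by positivity) (by positivity) hKC hKC₁
      (fun q g hq => ?_) (fun q g i hq => ?_) (fun q f _ => hC0 _ q f) (fun q f i _ => hC1 _ q f i)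
    · rw [applyKT_bondInd]; exact hΦ₀ q ν g hq
    · rw [applyKT_bondInd]; exact hΦ₁ q ν g i hq
  -- term 2: row end `r′Ga`, column end `Ga(·, b)`
  have ht2 : |bubble (Ga n a) (SbT μ u) (outer (bondInd ν b) r')| ≤ K * (KC₁ * (A₀ * c₂ * E₂) + KC * (A₁ * c₃ * E₃) + KC₁ * (A₁ * c₃ * E₃)) := by
    rw [bubble_eq_biBubble]
    refine hframe μ u (Ga n a) (Ga n a) (bondInd ν b) r' hsum2 KC KC₁ (A₀ * c₂ * E₂) (A₁ * c₃ * E₃) hKC hKC₁ (by positivity) (by positivity)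
      (fun q g _ => hT0 _ q g) (fun q g i _ => hT1 _ q g i) (fun q f hq => ?_) (fun q f i hq => ?_)
    · rw [applyK_bondInd]; exact hΓ₀' q f ν hq
    · rw [applyK_bondInd]; exact hΓ₁' q f ν i hq
  -- assemble
  rw [hword, abs_mul, show |(-(1 / 2 : ℝ))| = 1 / 2 by norm_num]
  have htri : |bubble (Ga n a) (SbT μ u) (outer c' (bondInd ν b)) - bubble (Ga n a) (SbT μ u) (outer (bondInd ν b) r')|
      ≤ |bubble (Ga n a) (SbT μ u) (outer c' (bondInd ν b))| + |bubble (Ga n a) (SbT μ u) (outer (bondInd ν b) r')| := by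
    rw [sub_eq_add_neg]; exact (abs_add_le _ _).trans (by rw [abs_neg])
  calc (1 / 2 : ℝ) * |bubble (Ga n a) (SbT μ u) (outer c' (bondInd ν b)) - bubble (Ga n a) (SbT μ u) (outer (bondInd ν b) r')|
      ≤ (1 / 2 : ℝ) * (K * (A₁ * c₃ * E₃ * KC + A₀ * c₂ * E₂ * KC₁ + A₁ * c₃ * E₃ * KC₁)
          + K * (KC₁ * (A₀ * c₂ * E₂) + KC * (A₁ * c₃ * E₃) + KC₁ * (A₁ * c₃ * E₃))) :=
        mul_le_mul_of_nonneg_left (htri.trans (add_le_add ht1 ht2)) (by norm_num)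
    _ = K * (A₁ * c₃ * E₃ * (KC + KC₁) + A₀ * c₂ * E₂ * KC₁) := by ring

end Word

end

end Summit.QuantumFields.BalabanUV.Beta.D1BFx.GluonLocalProjWord
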